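/-
Copyright: rh-split cell (screw, bridge) gen 18, 2026-08-28.  Splitting search over kernel-typed
RH-equivalences.  A splitting `A ∧ B ⟹ RH` is CONDITIONAL bookkeeping unless `A` and `B` are both
proved; nothing here bears on the truth of RH.
-/
import Summits.RiemannHypothesis.RiemannHypothesis.Theorems.Splittings.ScrewBlaschkeSeamB
import Summits.RiemannHypothesis.RiemannHypothesis.Theorems.Splittings.ScrewBlaschkeShielding
import HarnessLib

/-!
# Row X-SH: `CEIL(h) ∧ UNSH(h) ⟺ RH` — the quantitative floor of the one-lattice engine

Cell `rh-split`, seat `rh-split-screw-bridge` gen 18; card `cards/SPLIT-screw-bridge.md` §23 (census V121).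

THE CONJUNCT.  `TopUnshielded h` («UNSH(h)»): IF the supremal abscissa `Θ = sup Re ρ` exceeds `1/2` and is
NOT attained, THEN in some top layer TOP(δ) (`0 < δ ≤ Θ - 1/2`) some inverted pole `a = w_{ρ₁}`
(`w_ρ = r*/p_ρ`, `‖w_ρ‖ = e^{-(Θ - 1/2 - |Re ρ - 1/2|) h}`, `ScrewBlaschkeSeam.wp`) is UNSHIELDED by the other
top poles with the charges `b_ρ = c_ρ w_ρ/2` at some leak radius `r₁ ∈ (e^{-δ h}, 1)`
(for every `ε > 0` a finite set `F` of other top zeros and an `N` make the leak `r₁^(N+1)` and the `ℓ¹` tail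
both `≤ ε ‖a‖^N Π_F ‖bl (w_ρ) a‖` — the hypothesis `hun` of `ScrewBlaschkeShielding.cluster_charge_eq_zero_of_unshielded`).  Vacuous under RH
(`topUnshielded_of_rh`); implied by the Blaschke top layer `TBL` for every `h > 0`
(`topUnshielded_of_topBlaschke`, via `ScrewBlaschkeShielding.unshielded_of_blaschke`); `h`-DEPENDENT
(through `w_ρ = e^{(ρ - Θ) h}` up to the mirror convention) — unlike `TBL`.

THE SEAM (`shieldingTransparency`, kernel): `CEIL(h) ∧ UNSH(h) ⟹ RH` — the proof of
`ScrewBlaschkeSeam.blaschkeTransparency` with the quantitative rigidity theorem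
`ScrewBlaschkeShielding.cluster_charge_eq_zero_of_unshielded` in place of `cluster_charge_eq_zero`:
under `CEIL(h)` the inverted outside function `g(w) = H(r*/w)` is holomorphic on `‖w‖ > e^{-δ h}` and
carries the Borel expansion `Σ_TOP b_ρ/(w - w_ρ) = g(w) - Σ_TOP c_ρ/2` on `‖w‖ > 1`
(`ScrewBlaschkeSeam.differentiableOn_g`, `hasSum_g`); an unshielded pole has zero fibre charge; but every
fibre charge is `(a/2) Σ_{ρ ↦ a} c_ρ` with `Re c_ρ < 0`.

THE ROW (`latticeCeiling_and_topUnshielded_iff_rh`, unconditional, `h > 0`): `CEIL(h) ∧ UNSH(h) ⟺ RH`;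
formally below row X-19 (`CEIL(h) ∧ TBL ⟺ RH`) since `TBL ⟹ UNSH(h)`.  Its RH-free reading
(`latticeCeiling_dichotomy_shielded`): under `CEIL(h)`, either RH, or `Θ > 1/2` is not attained AND EVERY
top pole in EVERY top layer is SHIELDED at EVERY leak radius — for some `ε > 0`, no finite set of other top
zeros and no `N` bring leak and tail below `ε` times the shield; quantitatively
(`latticeCeiling_dichotomy_shieldDecay`, via `ScrewBlaschkeShielding.tail_gt_of_shielded`): at every top pole
the finite Blaschke products decay at least like the `1/(1+κ)`-th power of the `ℓ¹` charge tails,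
`κ = log (1/‖a‖) / log (‖a‖/r₁)`.  What the one-lattice engine cannot see is exactly the power-shielded,
non-attained top layers (card §23: shielding exponent `1 + κ`, Carleson sums `≫ log T`).

No `sorry`, no new axioms, no instances, no notation.  Nothing here bears on the truth of RH.
-/

set_option linter.dupNamespace false

noncomputable section

namespace Summit.RiemannHypothesis.RiemannHypothesis.Theorems.Splittings.ScrewShieldingSeam

open Complex Filter Topology Set Metric
open scoped ComplexConjugate
open Literature.NumberTheory.LFunctions
open ZetaZeros.riemannZetaNontrivialZeros
open Summit.RiemannHypothesis.RiemannHypothesis.Theorems.Splittings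
open Summit.RiemannHypothesis.RiemannHypothesis.Theorems.Splittings.ScrewLatticeContinuation
open Summit.RiemannHypothesis.RiemannHypothesis.Theorems.Splittings.ScrewBlaschkeTop
open Summit.RiemannHypothesis.RiemannHypothesis.Theorems.Splittings.ScrewBlaschkeRigidity
open Summit.RiemannHypothesis.RiemannHypothesis.Theorems.Splittings.ScrewBlaschkeSeam
open Summit.RiemannHypothesis.RiemannHypothesis.Theorems.Splittings.ScrewBlaschkeShielding

/-! ## 1. The conjunct UNSH(h) -/

/-- `UNSH(h)` («SOME TOP POLE IS UNSHIELDED»): if `Θ = sup Re ρ > 1/2` is not attained, then for some width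
`0 < δ ≤ Θ - 1/2`, some top zero `ρ₁ ∈ TOP(δ)` and some leak radius `e^{-δ h} < r₁ < 1`, the inverted pole
`w_{ρ₁}` is UNSHIELDED by the inverted top poles `w_ρ` with charges `c_ρ w_ρ / 2`: for every `ε > 0` some
finite set `F` of other top zeros and some `N` make LEAK `r₁^(N+1)` and TAIL both `≤ ε ‖w_{ρ₁}‖^N Π_F ‖bl (w_ρ) (w_{ρ₁})‖`.  `h`-dependent.  Open;
RH-implied (vacuously: `topUnshielded_of_rh`); implied by `TBL` (`topUnshielded_of_topBlaschke`). -/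
@[conjecture] def TopUnshielded (h : ℝ) : Prop :=
  1 / 2 < supRe → (∀ ρ : ℂ, ρ ∈ ZetaZeros.riemannZetaNontrivialZeros → ρ.re < supRe) →
    ∃ δ : ℝ, 0 < δ ∧ δ ≤ supRe - 1 / 2 ∧ ∃ ρ₁ : topSet δ, ∃ r₁ : ℝ,
      Real.exp (-(δ * h)) < r₁ ∧ r₁ < 1 ∧
        ∀ ε : ℝ, 0 < ε → ∃ F : Finset (topSet δ), (∀ ρ ∈ F, wp h ρ ≠ wp h ρ₁) ∧ ∃ N : ℕ,
          r₁ ^ (N + 1) ≤ ε * (‖wp h ρ₁‖ ^ N * ∏ ρ ∈ F, ‖bl (wp h ρ) (wp h ρ₁)‖) ∧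
          ∑' ρ : {ρ : topSet δ // ρ ∉ F ∧ wp h ρ ≠ wp h ρ₁},
              ‖coeff ((ρ : topSet δ) : ZetaZeros.riemannZetaNontrivialZeros) * wp h (ρ : topSet δ) / 2‖ *
                ‖wp h (ρ : topSet δ)‖ ^ N ≤
            ε * (‖wp h ρ₁‖ ^ N * ∏ ρ ∈ F, ‖bl (wp h ρ) (wp h ρ₁)‖)

/-- `RH ⟹ UNSH(h)` (vacuously: under RH `Θ = 1/2`). -/
theorem topUnshielded_of_rh (hRH : RiemannHypothesis) (h : ℝ) : TopUnshielded h := by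
  intro hΘ
  have := rh_iff_supRe_eq_half.1 hRH
  linarith

/-- The charges `b_ρ = c_ρ w_ρ / 2` of the top layer are `ℓ¹` (when `Θ` is not attained). -/
theorem summable_norm_charge {h δ : ℝ} (hh : 0 < h)
    (hlt : ∀ ρ : ℂ, ρ ∈ ZetaZeros.riemannZetaNontrivialZeros → ρ.re < supRe) :
    Summable fun ρ : topSet δ ↦ ‖coeff ρ * wp h ρ / 2‖ := by
  refine Summable.of_nonneg_of_le (fun _ ↦ norm_nonneg _) (fun ρ ↦ ?_)
    (summable_norm_coeff.subtype (topSet δ))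
  rw [norm_div, norm_mul]
  have : ‖(2 : ℂ)‖ = 2 := by simp
  rw [this]
  have h1 := (norm_wp_lt_one hh hlt ρ).le
  have h2 := norm_nonneg (coeff (ρ : ZetaZeros.riemannZetaNontrivialZeros))
  show ‖coeff (ρ : ZetaZeros.riemannZetaNontrivialZeros)‖ * ‖wp h ρ‖ / 2 ≤
    ‖coeff (ρ : ZetaZeros.riemannZetaNontrivialZeros)‖
  nlinarith

/-- **`TBL ⟹ UNSH(h)`** for every `h > 0`: a Blaschke top layer is unshielded at every one of its poles
(`ScrewBlaschkeShielding.unshielded_of_blaschke` with `ScrewBlaschkeSeam.summable_one_sub_norm_wp`). -/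
theorem topUnshielded_of_topBlaschke {h : ℝ} (hh : 0 < h) (htbl : TopBlaschke) : TopUnshielded h := by
  intro hΘ hlt
  obtain ⟨δ₀, hδ₀, hBL₀⟩ := htbl
  set δ : ℝ := min δ₀ (supRe - 1 / 2) with hδdef
  have hδ : 0 < δ := lt_min hδ₀ (by linarith)
  have hδΘ : δ ≤ supRe - 1 / 2 := min_le_right _ _
  have hBL : BlaschkeTop δ := blaschkeTop_mono (min_le_left _ _) hBL₀
  -- a zero in the top layer and its inverted pole `a`
  obtain ⟨ρ₁, hρ₁, hβ₁⟩ := exists_lt_re_of_lt_supRe (show supRe - δ < supRe by linarith)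
  have htop₁ : (⟨ρ₁, hρ₁⟩ : ZetaZeros.riemannZetaNontrivialZeros) ∈ topSet δ := by
    show supRe - 1 / 2 - δ < |ρ₁.re - 1 / 2|
    exact lt_of_lt_of_le (by linarith) (le_abs_self _)
  set ρ₁' : topSet δ := ⟨⟨ρ₁, hρ₁⟩, htop₁⟩ with hρ₁'
  set a : ℂ := wp h ((ρ₁' : topSet δ) : ZetaZeros.riemannZetaNontrivialZeros) with ha_def
  have ha : Real.exp (-(δ * h)) < ‖a‖ := exp_neg_lt_norm_wp hh ρ₁'.2
  have ha1 : ‖a‖ < 1 := norm_wp_lt_one hh hlt _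
  -- the leak radius `r₁ = (e^{-δh} + ‖a‖)/2`
  set r₁ : ℝ := (Real.exp (-(δ * h)) + ‖a‖) / 2 with hr₁
  have hr₁ρ : Real.exp (-(δ * h)) < r₁ := by rw [hr₁]; linarith
  have hr₁a : r₁ < ‖a‖ := by rw [hr₁]; linarith
  have hr₁0 : 0 ≤ r₁ := ((Real.exp_pos _).trans hr₁ρ).le
  refine ⟨δ, hδ, hδΘ, ρ₁', r₁, hr₁ρ, hr₁a.trans ha1, ?_⟩
  intro ε hε
  exact unshielded_of_blaschke (ι := topSet δ) (w := fun ρ ↦ wp h ρ) (b := fun ρ ↦ coeff ρ * wp h ρ / 2)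
    (fun ρ ↦ norm_wp_lt_one hh hlt ρ) (summable_one_sub_norm_wp hh hlt hBL) (summable_norm_charge hh hlt)
    ha1 hr₁0 hr₁a ε hε

/-! ## 2. The kernel seam and the row -/

/-- **THE SEAM** (kernel): `CEIL(h) ∧ UNSH(h) ⟹ RH` (`h > 0`). -/
theorem shieldingTransparency {h : ℝ} (hh : 0 < h) (hceil : LatticeCeiling h) (hT : TopUnshielded h) :
    RiemannHypothesis := by
  by_contra hRH
  rcases latticeCeiling_dichotomy_top hh hceil with hrh | ⟨hΘ, hlt, -⟩
  · exact hRH hrh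
  obtain ⟨δ, hδ, hδΘ, ρ₁, r₁, hr₁ρ, hr₁1, hun⟩ := hT hΘ hlt
  have hceil' : LatticeCeiling h := hceil
  set a : ℂ := wp h (ρ₁ : ZetaZeros.riemannZetaNontrivialZeros) with ha_def
  have ha : Real.exp (-(δ * h)) < ‖a‖ := exp_neg_lt_norm_wp hh ρ₁.2
  have ha1 : ‖a‖ < 1 := norm_wp_lt_one hh hlt _
  have ha0 : a ≠ 0 := norm_pos_iff.1 ((Real.exp_pos _).trans ha)
  haveI : Countable ZetaZeros.riemannZetaNontrivialZeros := riemannZetaNontrivialZeros_countable.to_subtype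
  -- THE QUANTITATIVE RIGIDITY THEOREM: the fibre of the unshielded pole `a` carries zero charge
  have key := cluster_charge_eq_zero_of_unshielded (ι := topSet δ) (w := fun ρ ↦ wp h ρ)
    (b := fun ρ ↦ coeff ρ * wp h ρ / 2) (ρ₀ := Real.exp (-(δ * h)))
    (g := fun w ↦ Hfun h δ ((rstar h : ℂ) / w)) (c₀ := ∑' ρ : topSet δ, coeff ρ / 2)
    (Real.exp_pos _).le (fun ρ ↦ norm_wp_lt_one hh hlt ρ) (summable_norm_charge hh hlt)
    (differentiableOn_g hh hδΘ hceil') (fun w hw ↦ hasSum_g hh hδ.le hδΘ hlt hceil' hw) ha0 ha1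
    hr₁ρ hr₁1 hun
  -- on the fibre, `b_ρ = (a/2) c_ρ`
  have e : (fun i : {i : topSet δ // wp h i = a} ↦
      coeff ((i : topSet δ) : ZetaZeros.riemannZetaNontrivialZeros) * wp h i / 2) =
      fun i : {i : topSet δ // wp h i = a} ↦
        a / 2 * coeff ((i : topSet δ) : ZetaZeros.riemannZetaNontrivialZeros) := by
    funext i
    rw [i.2]
    ring
  rw [e, tsum_mul_left] at key
  have hS : ∑' i : {i : topSet δ // wp h i = a},
      coeff ((i : topSet δ) : ZetaZeros.riemannZetaNontrivialZeros) = 0 := by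
    rcases mul_eq_zero.1 key with h0 | h0
    · exact absurd h0 (div_ne_zero ha0 two_ne_zero)
    · exact h0
  -- but the fibre sum has negative real part
  have hsum : Summable fun i : {i : topSet δ // wp h i = a} ↦
      coeff ((i : topSet δ) : ZetaZeros.riemannZetaNontrivialZeros) :=
    Summable.of_norm ((summable_norm_coeff.subtype (topSet δ)).subtype _)
  have hre : (∑' i : {i : topSet δ // wp h i = a},
      coeff ((i : topSet δ) : ZetaZeros.riemannZetaNontrivialZeros)).re =
      ∑' i : {i : topSet δ // wp h i = a},
        (coeff ((i : topSet δ) : ZetaZeros.riemannZetaNontrivialZeros)).re := Complex.re_tsum hsum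
  have hneg : Summable fun i : {i : topSet δ // wp h i = a} ↦
      -(coeff ((i : topSet δ) : ZetaZeros.riemannZetaNontrivialZeros)).re :=
    (Complex.hasSum_re hsum.hasSum).summable.neg
  set i₁ : {i : topSet δ // wp h i = a} := ⟨ρ₁, rfl⟩ with hi₁
  have hle := hneg.le_tsum i₁ (fun j _ ↦ by
    have := re_coeff_neg ((j : topSet δ) : ZetaZeros.riemannZetaNontrivialZeros)
    linarith)
  rw [tsum_neg] at hle
  have hlt₁ := re_coeff_neg ((i₁ : topSet δ) : ZetaZeros.riemannZetaNontrivialZeros)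
  rw [← hre, hS, Complex.zero_re] at hle
  linarith

/-- **ROW X-SH, unconditional** (`h > 0`): `CEIL(h) ∧ UNSH(h) ⟺ RH`. -/
theorem latticeCeiling_and_topUnshielded_iff_rh {h : ℝ} (hh : 0 < h) :
    ((∀ ε : ℝ, 0 < ε → ∃ K : ℝ, ∀ k : ℕ, |zetaScrew (k * h)| ≤ K * Real.exp (ε * k)) ∧
      TopUnshielded h) ↔ RiemannHypothesis :=
  ⟨fun hab ↦ shieldingTransparency hh hab.1 hab.2,
    fun hRH ↦ ⟨latticeCeiling_of_rh hRH h, topUnshielded_of_rh hRH h⟩⟩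

/-- `UNSH(h)` lies formally below the X-19 partner: `(MaxRe ∨ TBL) ⟹ UNSH(h)` (`h > 0`). -/
theorem topUnshielded_of_maxRe_or_topBlaschke {h : ℝ} (hh : 0 < h)
    (hB : (∃ ρ₀ : ℂ, ρ₀ ∈ ZetaZeros.riemannZetaNontrivialZeros ∧
        ∀ ρ : ℂ, ρ ∈ ZetaZeros.riemannZetaNontrivialZeros → ρ.re ≤ ρ₀.re) ∨ TopBlaschke) :
    TopUnshielded h := by
  rcases hB with ⟨ρ₀, hρ₀, hmax⟩ | htbl
  · intro hΘ hlt
    exact absurd (hlt ρ₀ hρ₀) (not_lt.2 (supRe_le fun ρ hρ ↦ hmax ρ hρ))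
  · exact topUnshielded_of_topBlaschke hh htbl

/-! ## 3. The RH-free reading: under `CEIL(h)`, unless RH, every top pole is shielded -/

/-- **SHIELDED RESIDUE** (RH-free, `h > 0`): under `CEIL(h)`, either RH holds, or `Θ > 1/2` is not attained and
in every top layer TOP(δ) (`0 < δ ≤ Θ - 1/2`) EVERY inverted pole is SHIELDED by the others at EVERY leak radius
`r₁ ∈ (e^{-δ h}, 1)`: for some `ε > 0` no finite set of other top zeros and no `N` bring both the leak `r₁^(N+1)`
and the `ℓ¹` tail below `ε ‖w_{ρ₁}‖^N Π_F ‖bl (w_ρ) (w_{ρ₁})‖`. -/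
theorem latticeCeiling_dichotomy_shielded {h : ℝ} (hh : 0 < h)
    (hceil : ∀ ε : ℝ, 0 < ε → ∃ K : ℝ, ∀ k : ℕ, |zetaScrew (k * h)| ≤ K * Real.exp (ε * k)) :
    RiemannHypothesis ∨
      (1 / 2 < supRe ∧ (∀ ρ : ℂ, ρ ∈ ZetaZeros.riemannZetaNontrivialZeros → ρ.re < supRe) ∧
        ∀ δ : ℝ, 0 < δ → δ ≤ supRe - 1 / 2 → ∀ ρ₁ : topSet δ, ∀ r₁ : ℝ,
          Real.exp (-(δ * h)) < r₁ → r₁ < 1 →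
            ∃ ε : ℝ, 0 < ε ∧ ∀ F : Finset (topSet δ), (∀ ρ ∈ F, wp h ρ ≠ wp h ρ₁) → ∀ N : ℕ,
              r₁ ^ (N + 1) ≤ ε * (‖wp h ρ₁‖ ^ N * ∏ ρ ∈ F, ‖bl (wp h ρ) (wp h ρ₁)‖) →
              ε * (‖wp h ρ₁‖ ^ N * ∏ ρ ∈ F, ‖bl (wp h ρ) (wp h ρ₁)‖) <
                ∑' ρ : {ρ : topSet δ // ρ ∉ F ∧ wp h ρ ≠ wp h ρ₁},
                  ‖coeff ((ρ : topSet δ) : ZetaZeros.riemannZetaNontrivialZeros) * wp h (ρ : topSet δ) / 2‖ *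
                    ‖wp h (ρ : topSet δ)‖ ^ N) := by
  rcases latticeCeiling_dichotomy_top hh hceil with hRH | ⟨hΘ, hlt, -⟩
  · exact Or.inl hRH
  · by_cases hRH : RiemannHypothesis
    · exact Or.inl hRH
    · refine Or.inr ⟨hΘ, hlt, fun δ hδ hδΘ ρ₁ r₁ hr₁ hr₁1 ↦ ?_⟩
      by_contra hun
      refine hRH (shieldingTransparency hh hceil fun _ _ ↦ ⟨δ, hδ, hδΘ, ρ₁, r₁, hr₁, hr₁1, ?_⟩)
      intro ε hε
      by_contra hcon
      refine hun ⟨ε, hε, fun F hF N h1 ↦ ?_⟩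
      by_contra h2
      exact hcon ⟨F, hF, N, h1, not_lt.1 h2⟩

/-- **SHIELD DECAY** (RH-free, `h > 0`; the ζ-reading of `ScrewBlaschkeShielding.tail_gt_of_shielded`):
under `CEIL(h)`, either RH holds, or `Θ > 1/2` is not attained and at EVERY top pole `a = w_{ρ₁}` of every top
layer TOP(δ) and EVERY leak radius `e^{-δ h} < r₁ < ‖a‖` there is `c₀ > 0` with
`c₀ · (Π_{ρ∈F} ‖bl (w_ρ) a‖)^(1+κ) < Σ_{ρ∉F, w_ρ≠a} ‖c_ρ w_ρ/2‖` for every finite set `F` of other top zeros,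
`κ = shieldExp a r₁` (`= d₁/(δ₁-d₁)` for `‖a‖ = e^{-d₁h}`, `r₁ = e^{-δ₁h}`): the finite Blaschke products at every
top pole DECAY at least like the `1/(1+κ)`-th power of the `ℓ¹` charge tails.  (Card §23 (4): with
`F = {ρ : |Im ρ| ≤ T}` and Riemann–von Mangoldt this reads «Carleson sum at `a` up to height `T`
`≥ ((δ₁-d₁)/δ₁ - o(1)) log T`».) -/
theorem latticeCeiling_dichotomy_shieldDecay {h : ℝ} (hh : 0 < h)
    (hceil : ∀ ε : ℝ, 0 < ε → ∃ K : ℝ, ∀ k : ℕ, |zetaScrew (k * h)| ≤ K * Real.exp (ε * k)) :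
    RiemannHypothesis ∨
      (1 / 2 < supRe ∧ (∀ ρ : ℂ, ρ ∈ ZetaZeros.riemannZetaNontrivialZeros → ρ.re < supRe) ∧
        ∀ δ : ℝ, 0 < δ → δ ≤ supRe - 1 / 2 → ∀ ρ₁ : topSet δ, ∀ r₁ : ℝ,
          Real.exp (-(δ * h)) < r₁ → r₁ < ‖wp h ρ₁‖ →
            ∃ c₀ : ℝ, 0 < c₀ ∧ ∀ F : Finset (topSet δ), (∀ ρ ∈ F, wp h ρ ≠ wp h ρ₁) →
              c₀ * (∏ ρ ∈ F, ‖bl (wp h ρ) (wp h ρ₁)‖) ^ (1 + shieldExp (wp h ρ₁) r₁) <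
                ∑' ρ : {ρ : topSet δ // ρ ∉ F ∧ wp h ρ ≠ wp h ρ₁},
                  ‖coeff ((ρ : topSet δ) : ZetaZeros.riemannZetaNontrivialZeros) * wp h (ρ : topSet δ) / 2‖) := by
  rcases latticeCeiling_dichotomy_shielded hh hceil with hRH | ⟨hΘ, hlt, hsh⟩
  · exact Or.inl hRH
  · refine Or.inr ⟨hΘ, hlt, fun δ hδ hδΘ ρ₁ r₁ hr₁ hr₁a ↦ ?_⟩
    have ha1 : ‖wp h ρ₁‖ < 1 := norm_wp_lt_one hh hlt ρ₁
    have hr₁0 : 0 < r₁ := (Real.exp_pos _).trans hr₁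
    have ha0 : 0 < ‖wp h ρ₁‖ := hr₁0.trans hr₁a
    obtain ⟨ε, hε, hε'⟩ := hsh δ hδ hδΘ ρ₁ r₁ hr₁ (hr₁a.trans ha1)
    -- shrink the shielding constant to `ε₁ = min ε 1 ≤ 1` (shieldedness is monotone in `ε`)
    set ε₁ : ℝ := min ε 1 with hε₁
    have hε₁0 : 0 < ε₁ := lt_min hε one_pos
    have hε₁1 : ε₁ ≤ 1 := min_le_right _ _
    have hε₁ε : ε₁ ≤ ε := min_le_left _ _
    have hsh₁ : ∀ F : Finset (topSet δ), (∀ ρ ∈ F, wp h ρ ≠ wp h ρ₁) → ∀ N : ℕ,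
        r₁ ^ (N + 1) ≤ ε₁ * (‖wp h ρ₁‖ ^ N * ∏ ρ ∈ F, ‖bl (wp h ρ) (wp h ρ₁)‖) →
        ε₁ * (‖wp h ρ₁‖ ^ N * ∏ ρ ∈ F, ‖bl (wp h ρ) (wp h ρ₁)‖) <
          ∑' ρ : {ρ : topSet δ // ρ ∉ F ∧ wp h ρ ≠ wp h ρ₁},
            ‖coeff ((ρ : topSet δ) : ZetaZeros.riemannZetaNontrivialZeros) * wp h (ρ : topSet δ) / 2‖ *
              ‖wp h (ρ : topSet δ)‖ ^ N := by
      intro F hF N h1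
      have hS : 0 ≤ ‖wp h ρ₁‖ ^ N * ∏ ρ ∈ F, ‖bl (wp h ρ) (wp h ρ₁)‖ := by positivity
      have hmono : ε₁ * (‖wp h ρ₁‖ ^ N * ∏ ρ ∈ F, ‖bl (wp h ρ) (wp h ρ₁)‖) ≤
          ε * (‖wp h ρ₁‖ ^ N * ∏ ρ ∈ F, ‖bl (wp h ρ) (wp h ρ₁)‖) :=
        mul_le_mul_of_nonneg_right hε₁ε hS
      exact lt_of_le_of_lt hmono (hε' F hF N (h1.trans hmono))
    refine ⟨ε₁ ^ (1 + shieldExp (wp h ρ₁) r₁) * ‖wp h ρ₁‖,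
      mul_pos (Real.rpow_pos_of_pos hε₁0 _) ha0, fun F hF ↦ ?_⟩
    exact tail_gt_of_shielded (ι := topSet δ) (w := fun ρ ↦ wp h ρ)
      (b := fun ρ ↦ coeff ρ * wp h ρ / 2) (fun ρ ↦ norm_wp_lt_one hh hlt ρ) (summable_norm_charge hh hlt)
      ha1 hr₁0 hr₁a hε₁0 hε₁1 hsh₁ F hF

end Summit.RiemannHypothesis.RiemannHypothesis.Theorems.Splittings.ScrewShieldingSeam
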